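import Summits.QuantumFields.YangMills.Theorems.UnitScaleTiltCoverFlatOpsCore
import Summits.QuantumFields.YangMills.Theorems.UnitScaleTiltCoverAdjoint
import Summits.QuantumFields.YangMills.Theorems.UnitScaleTiltCoverStencils
import HarnessLib

/-!
# Route `UnitScaleTilt`, crux K1 «MinimiserStabilityRegPr» (stmt-QuantumFields-19200), leaf V2′ `stub_halvingStep` — branch (P2-small) «H-SMALL», mechanism (α)
# COVERING ∕ PERIODISATION (★★OWNER RULING g26-№18): **brick α3c-GENERIC — `Δ_a`, `Q`, `Q*` INTERTWINE WITH THE `ℓ²` PULLBACK OF A LATTICE COVERING, HENCE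
# `H = GQ*(QGQ*)⁻¹` DOES** (the assembly of ✓α4-core + ✓α3-core + ✓α3a; the multi-scale `Q`∕`Q′` facts enter as four displayed function-level hypotheses,
# discharged by ✓α3b-generic `…CoverAverages` + α2's `projIdx`)

Cell `ym3-torus` (HUMAN RULING D-0037, YM ladder rung R3 — continuum SU(2) YM₃ on the torus is a RUNG, not the Clay problem), width seat `ym-ust-19200-w5` gen 3
(LEAD (S3), H-SMALL planner).  `--supports stmt-QuantumFields-19200 --as helper`; def-free, 0 sorry, standard axioms.

SETTING.  Lattices `P`, `P′` (`hd : P′.d = P.d`), the level-0 map `φ : Site P′ 0 → Site P 0` with `φ(x ± e_μ) = φ x ± e_μ`; families `D` (on `P`), `D′` (on `P′`) with index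
maps `ψI : 𝔅(D′) → 𝔅(D)`, `ψS : Λ-sites(D′) → Λ-sites(D)`; the `ℓ²` PULLBACKS are the explicit linear maps `πS∕πB∕πP∕πI∕πSI := onE (LinearMap.funLeft ℝ ℝ _)`
(`B6SectAOperatorsV1.onE`); the PUSHFORWARDS `ρS ρB ρP ρI ρSI` are ANY linear maps with the fibre-sum property (displayed pointwise hypotheses — the assembler
builds them with `LinearMap.mk`, they never enter a statement of record).  The four multi-scale hypotheses (function level): `hQpull`, `hQpush` (`Q_j` vs
pullback∕pushforward through `ψI`), `hQ'pull`, `hQ'push` (`Q′_j` through `ψS`) — ✓`CoverAverages.bondAvgIter_comp∕_push`, `siteAvgIter_comp∕_push` read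
through α2's `projIdx`∕`projSIdx`.
RESULTS (ns `…CoverFlatOps`): `inner_pull_eq` (adjointness), `dE_pull`, `dsE_pull`, `dcE_pull`, `lapE_pull`, `dcE_push`, `lapE_push`, `dcsE_pull`, `QE_pull`, `QE_push`,
`QsE_pull`, `QpE_pull`, `QpE_push`, `aE_pull`, `KE_map_subset`, `KE_push_subset`, `RE_pull`, ★`deltaAE_pull`, ★★`hOp_pull` (`H′(πI ω) = πB(H ω)`) and `Gt_pull`.
NOT a claim about the mass gap.

References: T. Bałaban, CMP **96** (1984) 223–250 [Balaban1984PropagatorsII] ((2.10)–(2.12) p.225, (2.18)–(2.22) p.226, (2.35) p.228).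
-/

noncomputable section

open scoped BigOperators Classical InnerProductSpace

namespace Summit.QuantumFields.YangMills.Theorems.CoverFlatOps

open Literature.MathematicalPhysics.QuantumFieldTheory.Balaban1983to89
open LatticeFieldCalculus (grad diverg curl laplace siteAvgIter bondAvgIter)
open B6SectADomainsV1 (Domains)
open B6SectAOperatorsV1 (onE inner_eq_sum ScalarSpace SiteIdx BondIdx SiteIdxSpace BondIdxSpace dE dsE dcE dcsE QE QpE QsE aE lapE KE RE
  dE_apply dsE_apply dcE_apply QE_apply QpE_apply aE_apply lapE_apply RE_apply)
open B6SectAVectorModelV1 (deltaAE GE EE)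
open B6SectA (hOp)
open Literature.MathematicalPhysics.QuantumFieldTheory.BalabanImbrieJaffe1984to88.BIJ85AxialPropagator411 (BondSpace PlaqSpace)
open CoverStencils

variable {P P' : Params} (hd : P'.d = P.d) (φ : Site P' 0 → Site P 0)
  (hs : ∀ (x : Site P' 0) (μ : Fin P'.d), φ (x.shift μ) = (φ x).shift (Fin.cast hd μ))
  (hu : ∀ (x : Site P' 0) (μ : Fin P'.d), φ (x.unshift μ) = (φ x).unshift (Fin.cast hd μ))

/-! ## §1 Generic `ℓ²` bookkeeping: pullback = `onE ∘ funLeft`, pushforward = fibre sums, adjointness -/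

/-- the pullback read componentwise. [folklore] -/
theorem onE_funLeft_apply {α β : Type*} [Fintype α] [Fintype β] (ψ : α → β) (f : EuclideanSpace ℝ β) (a : α) :
    onE (LinearMap.funLeft ℝ ℝ ψ) f a = f (ψ a) := rfl

/-- **ADJOINTNESS** of the pullback along `ψ` and any fibre-sum pushforward `ρ`. [cite: Balaban1984PropagatorsII, (2.8) p.224] -/
theorem inner_pull_eq {α β : Type*} [Fintype α] [Fintype β] [DecidableEq β] (ψ : α → β) (ρ : EuclideanSpace ℝ α →ₗ[ℝ] EuclideanSpace ℝ β)
    (hρ : ∀ (g : EuclideanSpace ℝ α) (b : β), ρ g b = ∑ a : {a // ψ a = b}, g a) (f : EuclideanSpace ℝ β) (g : EuclideanSpace ℝ α) :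
    ⟪onE (LinearMap.funLeft ℝ ℝ ψ) f, g⟫_ℝ = ⟪f, ρ g⟫_ℝ := by
  rw [inner_eq_sum, inner_eq_sum]
  simp only [onE_funLeft_apply, hρ]
  convert sum_comp_mul_eq_sum_mul_fibre ψ (fun b => f b) (fun a => g a) using 3
  exact Finset.sum_congr (by ext; simp) (fun _ _ => rfl)

/-! ## §2 The level-0 stencils on `ℓ²` -/

section Stencils


include hs in
/-- `∂′ ∘ πS = πB ∘ ∂`. [cite: Balaban1984PropagatorsII, (2.7) p.224] -/
theorem dE_pull (c : ℝ) (f : ScalarSpace P) :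
    dE c (onE (LinearMap.funLeft ℝ ℝ φ) f) = onE (LinearMap.funLeft ℝ ℝ (fun b' : PBond P' 0 => (⟨φ b'.src, Fin.cast hd b'.dir⟩ : PBond P 0))) (dE c f) := by
  ext b'
  rw [dE_apply, onE_funLeft_apply, dE_apply]
  exact grad_comp hd φ hs c (WithLp.ofLp f) b'

include hu in
/-- `∂*′ ∘ πB = πS ∘ ∂*` (the divergence as a stencil). [cite: Balaban1984PropagatorsII, (2.8) p.224] -/
theorem dsE_pull (c : ℝ) (u : BondSpace P) :
    dsE c (onE (LinearMap.funLeft ℝ ℝ (fun b' : PBond P' 0 => (⟨φ b'.src, Fin.cast hd b'.dir⟩ : PBond P 0))) u) = onE (LinearMap.funLeft ℝ ℝ φ) (dsE c u) := by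
  ext x'
  rw [dsE_apply, onE_funLeft_apply, dsE_apply]
  exact diverg_comp hd φ hu c (WithLp.ofLp u) x'

include hs in
/-- `curl′ ∘ πB = πP ∘ curl`. [cite: Balaban1984PropagatorsII, (2.5) p.224] -/
theorem dcE_pull (c : ℝ) (u : BondSpace P) :
    dcE c (onE (LinearMap.funLeft ℝ ℝ (fun b' : PBond P' 0 => (⟨φ b'.src, Fin.cast hd b'.dir⟩ : PBond P 0))) u) = onE (LinearMap.funLeft ℝ ℝ (fun p' : Plaq P' 0 => (⟨φ p'.src, Fin.cast hd p'.μ, Fin.cast hd p'.ν, Fin.lt_def.mpr (Fin.lt_def.mp p'.hμν)⟩ : Plaq P 0))) (dcE c u) := by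
  ext p'
  rw [dcE_apply, onE_funLeft_apply, dcE_apply]
  exact curl_comp hd φ hs c (WithLp.ofLp u) p'

include hs hu in
/-- `Δ′ ∘ πS = πS ∘ Δ`. [cite: Balaban1984PropagatorsII, (2.8) p.224] -/
theorem lapE_pull (c : ℝ) (f : ScalarSpace P) :
    lapE c (onE (LinearMap.funLeft ℝ ℝ φ) f) = onE (LinearMap.funLeft ℝ ℝ φ) (lapE c f) := by
  ext x'
  rw [lapE_apply, onE_funLeft_apply, lapE_apply]
  exact laplace_comp hd φ hs hu c (WithLp.ofLp f) x'

include hs hu in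
/-- `curl ∘ ρB = ρP ∘ curl′` (pushforwards). [cite: Balaban1984PropagatorsII, (2.5) p.224] -/
theorem dcE_push (c : ℝ) (ρB : BondSpace P' →ₗ[ℝ] BondSpace P) (ρP : PlaqSpace P' →ₗ[ℝ] PlaqSpace P)
    (hρB : ∀ (g : BondSpace P') (b : PBond P 0), ρB g b = ∑ b' : {b' : PBond P' 0 // (⟨φ b'.src, Fin.cast hd b'.dir⟩ : PBond P 0) = b}, g b')
    (hρP : ∀ (g : PlaqSpace P') (p : Plaq P 0), ρP g p = ∑ p' : {p' : Plaq P' 0 // (⟨φ p'.src, Fin.cast hd p'.μ, Fin.cast hd p'.ν, Fin.lt_def.mpr (Fin.lt_def.mp p'.hμν)⟩ : Plaq P 0) = p}, g p') (v : BondSpace P') :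
    dcE c (ρB v) = ρP (dcE c v) := by
  ext p
  obtain ⟨x, μ, ν, hμν⟩ := p
  have hμ : μ = Fin.cast hd (Fin.cast hd.symm μ) := Fin.ext rfl
  have hν : ν = Fin.cast hd (Fin.cast hd.symm ν) := Fin.ext rfl
  have hμν' : Fin.cast hd.symm μ < Fin.cast hd.symm ν := Fin.lt_def.mpr (Fin.lt_def.mp hμν)
  have hp : (⟨x, μ, ν, hμν⟩ : Plaq P 0) = ⟨x, Fin.cast hd (Fin.cast hd.symm μ), Fin.cast hd (Fin.cast hd.symm ν), Fin.lt_def.mpr (Fin.lt_def.mp hμν')⟩ := by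
    cases hμ; cases hν; rfl
  rw [hp, dcE_apply, hρP]
  have hfun : WithLp.ofLp (ρB v) = fun b : PBond P 0 => ∑ b' : {b' : PBond P' 0 // (⟨φ b'.src, Fin.cast hd b'.dir⟩ : PBond P 0) = b}, (WithLp.ofLp v) b' := funext fun b => hρB v b
  rw [hfun, curl_push hd φ hs hu c (WithLp.ofLp v) x _ _ hμν']
  exact Finset.sum_congr rfl fun p' _ => (dcE_apply c v p'.1).symm

include hs hu in
/-- `Δ ∘ ρS = ρS ∘ Δ′` (pushforwards). [cite: Balaban1984PropagatorsII, (2.8) p.224] -/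
theorem lapE_push (c : ℝ) (ρS : ScalarSpace P' →ₗ[ℝ] ScalarSpace P)
    (hρS : ∀ (g : ScalarSpace P') (x : Site P 0), ρS g x = ∑ x' : {x' // φ x' = x}, g x') (g : ScalarSpace P') :
    lapE c (ρS g) = ρS (lapE c g) := by
  ext x
  rw [lapE_apply, hρS]
  have hfun : WithLp.ofLp (ρS g) = fun y : Site P 0 => ∑ y' : {y' // φ y' = y}, (WithLp.ofLp g) y' := funext fun y => hρS g y
  rw [hfun, laplace_push hd φ hs hu c (WithLp.ofLp g) x]
  exact Finset.sum_congr rfl fun x' _ => (lapE_apply c g x'.1).symm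

include hs hu in
/-- **`∂*′ ∘ πP = πB ∘ ∂*`** for the ADJOINT `dcsE = (curl)†` (via ✓`adjoint_intertwine_of_push` and `dcE_push`). [cite: Balaban1984PropagatorsII, (2.19) p.226] -/
theorem dcsE_pull (c : ℝ) (ρB : BondSpace P' →ₗ[ℝ] BondSpace P) (ρP : PlaqSpace P' →ₗ[ℝ] PlaqSpace P)
    (hρB : ∀ (g : BondSpace P') (b : PBond P 0), ρB g b = ∑ b' : {b' : PBond P' 0 // (⟨φ b'.src, Fin.cast hd b'.dir⟩ : PBond P 0) = b}, g b')
    (hρP : ∀ (g : PlaqSpace P') (p : Plaq P 0), ρP g p = ∑ p' : {p' : Plaq P' 0 // (⟨φ p'.src, Fin.cast hd p'.μ, Fin.cast hd p'.ν, Fin.lt_def.mpr (Fin.lt_def.mp p'.hμν)⟩ : Plaq P 0) = p}, g p') (g : PlaqSpace P) :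
    dcsE c (onE (LinearMap.funLeft ℝ ℝ (fun p' : Plaq P' 0 => (⟨φ p'.src, Fin.cast hd p'.μ, Fin.cast hd p'.ν, Fin.lt_def.mpr (Fin.lt_def.mp p'.hμν)⟩ : Plaq P 0))) g) = onE (LinearMap.funLeft ℝ ℝ (fun b' : PBond P' 0 => (⟨φ b'.src, Fin.cast hd b'.dir⟩ : PBond P 0))) (dcsE c g) :=
  adjoint_intertwine_of_push (dcE c) (dcE c) (onE (LinearMap.funLeft ℝ ℝ (fun b' : PBond P' 0 => (⟨φ b'.src, Fin.cast hd b'.dir⟩ : PBond P 0)))) (onE (LinearMap.funLeft ℝ ℝ (fun p' : Plaq P' 0 => (⟨φ p'.src, Fin.cast hd p'.μ, Fin.cast hd p'.ν, Fin.lt_def.mpr (Fin.lt_def.mp p'.hμν)⟩ : Plaq P 0)))) ρB ρP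
    (inner_pull_eq _ ρB hρB) (inner_pull_eq _ ρP hρP) (dcE_push hd φ hs hu c ρB ρP hρB hρP) g

include hs hu in
/-- **THE `∂*∂` SUMMAND** of `Δ_a` intertwines. [cite: Balaban1984PropagatorsII, (2.19) p.226] -/
theorem curlCurl_pull (c : ℝ) (ρB : BondSpace P' →ₗ[ℝ] BondSpace P) (ρP : PlaqSpace P' →ₗ[ℝ] PlaqSpace P)
    (hρB : ∀ (g : BondSpace P') (b : PBond P 0), ρB g b = ∑ b' : {b' : PBond P' 0 // (⟨φ b'.src, Fin.cast hd b'.dir⟩ : PBond P 0) = b}, g b')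
    (hρP : ∀ (g : PlaqSpace P') (p : Plaq P 0), ρP g p = ∑ p' : {p' : Plaq P' 0 // (⟨φ p'.src, Fin.cast hd p'.μ, Fin.cast hd p'.ν, Fin.lt_def.mpr (Fin.lt_def.mp p'.hμν)⟩ : Plaq P 0) = p}, g p') (u : BondSpace P) :
    (dcsE c ∘ₗ dcE c) (onE (LinearMap.funLeft ℝ ℝ (fun b' : PBond P' 0 => (⟨φ b'.src, Fin.cast hd b'.dir⟩ : PBond P 0))) u) = onE (LinearMap.funLeft ℝ ℝ (fun b' : PBond P' 0 => (⟨φ b'.src, Fin.cast hd b'.dir⟩ : PBond P 0))) ((dcsE c ∘ₗ dcE c) u) := by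
  rw [LinearMap.comp_apply, LinearMap.comp_apply, dcE_pull hd φ hs, dcsE_pull hd φ hs hu c ρB ρP hρB hρP]

end Stencils

/-! ## §3 The multi-scale pieces `Q`, `Q′`, `a`, `R` and the assembly -/

section Assembly

variable (D : Domains P) (D' : Domains P') (ψI : BondIdx D' → BondIdx D) (ψS : SiteIdx D' → SiteIdx D)


/-- **`Q′ ∘ πB = πI ∘ Q`** from the function-level multi-scale pullback fact `hQpull`. [cite: Balaban1984PropagatorsII, (2.20) p.226] -/
theorem QE_pull (hQpull : ∀ (A : PBond P 0 → ℝ) (c' : BondIdx D'),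
      bondAvgIter ((ψI c').1.1 : ℕ) A (ψI c').1.2 = bondAvgIter (c'.1.1 : ℕ) (fun b' : PBond P' 0 => A ⟨φ b'.src, Fin.cast hd b'.dir⟩) c'.1.2)
    (u : BondSpace P) : QE D' (onE (LinearMap.funLeft ℝ ℝ (fun b' : PBond P' 0 => (⟨φ b'.src, Fin.cast hd b'.dir⟩ : PBond P 0))) u) = onE (LinearMap.funLeft ℝ ℝ ψI) (QE D u) := by
  ext c'
  rw [QE_apply, onE_funLeft_apply, QE_apply, hQpull]
  rfl

/-- **`Q ∘ ρB = ρI ∘ Q′`** from the function-level multi-scale pushforward fact `hQpush`. [cite: Balaban1984PropagatorsII, (2.20) p.226] -/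
theorem QE_push (ρB : BondSpace P' →ₗ[ℝ] BondSpace P) (ρI : BondIdxSpace D' →ₗ[ℝ] BondIdxSpace D)
    (hρB : ∀ (g : BondSpace P') (b : PBond P 0), ρB g b = ∑ b' : {b' : PBond P' 0 // (⟨φ b'.src, Fin.cast hd b'.dir⟩ : PBond P 0) = b}, g b')
    (hρI : ∀ (g : BondIdxSpace D') (c : BondIdx D), ρI g c = ∑ c' : {c' // ψI c' = c}, g c')
    (hQpush : ∀ (g : PBond P' 0 → ℝ) (c : BondIdx D), (∑ c' : {c' // ψI c' = c}, bondAvgIter (c'.1.1.1 : ℕ) g c'.1.1.2) =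
      bondAvgIter (c.1.1 : ℕ) (fun b : PBond P 0 => ∑ b' : {b' : PBond P' 0 // (⟨φ b'.src, Fin.cast hd b'.dir⟩ : PBond P 0) = b}, g b') c.1.2)
    (v : BondSpace P') : QE D (ρB v) = ρI (QE D' v) := by
  ext c
  rw [QE_apply, hρI]
  have hfun : WithLp.ofLp (ρB v) = fun b : PBond P 0 => ∑ b' : {b' : PBond P' 0 // (⟨φ b'.src, Fin.cast hd b'.dir⟩ : PBond P 0) = b}, (WithLp.ofLp v) b' := funext fun b => hρB v b
  rw [hfun, ← hQpush]
  exact Finset.sum_congr rfl fun c' _ => (QE_apply D' v c'.1).symm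

/-- **`Q*′ ∘ πI = πB ∘ Q*`** for the ADJOINT (✓`adjoint_intertwine_of_push` + `QE_push`). [cite: Balaban1984PropagatorsII, (2.18) p.226] -/
theorem QsE_pull (ρB : BondSpace P' →ₗ[ℝ] BondSpace P) (ρI : BondIdxSpace D' →ₗ[ℝ] BondIdxSpace D)
    (hρB : ∀ (g : BondSpace P') (b : PBond P 0), ρB g b = ∑ b' : {b' : PBond P' 0 // (⟨φ b'.src, Fin.cast hd b'.dir⟩ : PBond P 0) = b}, g b')
    (hρI : ∀ (g : BondIdxSpace D') (c : BondIdx D), ρI g c = ∑ c' : {c' // ψI c' = c}, g c')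
    (hQpush : ∀ (g : PBond P' 0 → ℝ) (c : BondIdx D), (∑ c' : {c' // ψI c' = c}, bondAvgIter (c'.1.1.1 : ℕ) g c'.1.1.2) =
      bondAvgIter (c.1.1 : ℕ) (fun b : PBond P 0 => ∑ b' : {b' : PBond P' 0 // (⟨φ b'.src, Fin.cast hd b'.dir⟩ : PBond P 0) = b}, g b') c.1.2)
    (ω : BondIdxSpace D) : QsE D' (onE (LinearMap.funLeft ℝ ℝ ψI) ω) = onE (LinearMap.funLeft ℝ ℝ (fun b' : PBond P' 0 => (⟨φ b'.src, Fin.cast hd b'.dir⟩ : PBond P 0))) (QsE D ω) :=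
  adjoint_intertwine_of_push (QE D) (QE D') (onE (LinearMap.funLeft ℝ ℝ (fun b' : PBond P' 0 => (⟨φ b'.src, Fin.cast hd b'.dir⟩ : PBond P 0)))) (onE (LinearMap.funLeft ℝ ℝ ψI)) ρB ρI
    (inner_pull_eq _ ρB hρB) (inner_pull_eq _ ρI hρI) (QE_push hd φ D D' ψI ρB ρI hρB hρI hQpush) ω

/-- **`Q′′ ∘ πS = πSI ∘ Q′`** (sites). [cite: Balaban1984PropagatorsII, (2.14) p.225] -/
theorem QpE_pull (hQ'pull : ∀ (f : Site P 0 → ℝ) (s' : SiteIdx D'),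
      siteAvgIter ((ψS s').1.1 : ℕ) f (ψS s').1.2 = siteAvgIter (s'.1.1 : ℕ) (f ∘ φ) s'.1.2)
    (f : ScalarSpace P) : QpE D' (onE (LinearMap.funLeft ℝ ℝ φ) f) = onE (LinearMap.funLeft ℝ ℝ ψS) (QpE D f) := by
  ext s'
  rw [QpE_apply, onE_funLeft_apply, QpE_apply, hQ'pull]
  rfl

/-- **`Q′ ∘ ρS = ρSI ∘ Q′′`** (sites, pushforward). [cite: Balaban1984PropagatorsII, (2.14) p.225] -/
theorem QpE_push (ρS : ScalarSpace P' →ₗ[ℝ] ScalarSpace P) (ρSI : SiteIdxSpace D' →ₗ[ℝ] SiteIdxSpace D)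
    (hρS : ∀ (g : ScalarSpace P') (x : Site P 0), ρS g x = ∑ x' : {x' // φ x' = x}, g x')
    (hρSI : ∀ (g : SiteIdxSpace D') (s : SiteIdx D), ρSI g s = ∑ s' : {s' // ψS s' = s}, g s')
    (hQ'push : ∀ (g : Site P' 0 → ℝ) (s : SiteIdx D), (∑ s' : {s' // ψS s' = s}, siteAvgIter (s'.1.1.1 : ℕ) g s'.1.1.2) =
      siteAvgIter (s.1.1 : ℕ) (fun x : Site P 0 => ∑ x' : {x' // φ x' = x}, g x') s.1.2)
    (g : ScalarSpace P') : QpE D (ρS g) = ρSI (QpE D' g) := by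
  ext s
  rw [QpE_apply, hρSI]
  have hfun : WithLp.ofLp (ρS g) = fun x : Site P 0 => ∑ x' : {x' // φ x' = x}, (WithLp.ofLp g) x' := funext fun x => hρS g x
  rw [hfun, ← hQ'push]
  exact Finset.sum_congr rfl fun s' _ => (QpE_apply D' g s'.1).symm

/-- **`a′ ∘ πI = πI ∘ a`** for the lifted weights `w′ = w ∘ ψI`. [cite: Balaban1984PropagatorsII, (2.18) p.226] -/
theorem aE_pull (w : BondIdx D → ℝ) (ω : BondIdxSpace D) :
    aE D' (w ∘ ψI) (onE (LinearMap.funLeft ℝ ℝ ψI) ω) = onE (LinearMap.funLeft ℝ ℝ ψI) (aE D w ω) := by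
  ext c'
  rw [aE_apply, onE_funLeft_apply, onE_funLeft_apply, aE_apply, Function.comp_apply]

include hs hu in
/-- **THE GAUGE-FIXING PROJECTION**: `R′ ∘ πS = πS ∘ R` (✓`starProjection_intertwine_of_push` with the two `ΔN(Q′)`-inclusions).
[cite: Balaban1984PropagatorsII, (2.10)-(2.12) p.225] -/
theorem RE_pull (c : ℝ) (ρS : ScalarSpace P' →ₗ[ℝ] ScalarSpace P) (ρSI : SiteIdxSpace D' →ₗ[ℝ] SiteIdxSpace D)
    (hρS : ∀ (g : ScalarSpace P') (x : Site P 0), ρS g x = ∑ x' : {x' // φ x' = x}, g x')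
    (hρSI : ∀ (g : SiteIdxSpace D') (s : SiteIdx D), ρSI g s = ∑ s' : {s' // ψS s' = s}, g s')
    (hQ'pull : ∀ (f : Site P 0 → ℝ) (s' : SiteIdx D'),
      siteAvgIter ((ψS s').1.1 : ℕ) f (ψS s').1.2 = siteAvgIter (s'.1.1 : ℕ) (f ∘ φ) s'.1.2)
    (hQ'push : ∀ (g : Site P' 0 → ℝ) (s : SiteIdx D), (∑ s' : {s' // ψS s' = s}, siteAvgIter (s'.1.1.1 : ℕ) g s'.1.1.2) =
      siteAvgIter (s.1.1 : ℕ) (fun x : Site P 0 => ∑ x' : {x' // φ x' = x}, g x') s.1.2)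
    (f : ScalarSpace P) : RE D' c (onE (LinearMap.funLeft ℝ ℝ φ) f) = onE (LinearMap.funLeft ℝ ℝ φ) (RE D c f) := by
  rw [RE_apply, RE_apply]
  refine starProjection_intertwine_of_push (KE D c) (KE D' c) (onE (LinearMap.funLeft ℝ ℝ φ)) ρS (inner_pull_eq φ ρS hρS) ?_ ?_ f
  · -- `πS(ΔN(Q′)) ⊆ Δ′N(Q′′)`
    rintro k ⟨s, hs0, rfl⟩
    have hs0' : QpE D s = 0 := hs0
    refine ⟨onE (LinearMap.funLeft ℝ ℝ φ) s, ?_, lapE_pull hd φ hs hu c s⟩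
    show QpE D' (onE (LinearMap.funLeft ℝ ℝ φ) s) = 0
    rw [QpE_pull φ D D' ψS hQ'pull, hs0', map_zero]
  · -- `ρS(Δ′N(Q′′)) ⊆ ΔN(Q′)`
    rintro k' ⟨s', hs0, rfl⟩
    have hs0' : QpE D' s' = 0 := hs0
    refine ⟨ρS s', ?_, lapE_push hd φ hs hu c ρS hρS s'⟩
    show QpE D (ρS s') = 0
    rw [QpE_push φ D D' ψS ρS ρSI hρS hρSI hQ'push, hs0', map_zero]

include hs hu in
/-- ★ **`Δ_a′ ∘ πB = πB ∘ Δ_a`** (all three summands; weights `w′ = w ∘ ψI`, same lattice factor `c`). [cite: Balaban1984PropagatorsII, (2.19) p.226] -/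
theorem deltaAE_pull (c : ℝ) (w : BondIdx D → ℝ)
    (ρS : ScalarSpace P' →ₗ[ℝ] ScalarSpace P) (ρB : BondSpace P' →ₗ[ℝ] BondSpace P) (ρP : PlaqSpace P' →ₗ[ℝ] PlaqSpace P)
    (ρI : BondIdxSpace D' →ₗ[ℝ] BondIdxSpace D) (ρSI : SiteIdxSpace D' →ₗ[ℝ] SiteIdxSpace D)
    (hρS : ∀ (g : ScalarSpace P') (x : Site P 0), ρS g x = ∑ x' : {x' // φ x' = x}, g x')
    (hρB : ∀ (g : BondSpace P') (b : PBond P 0), ρB g b = ∑ b' : {b' : PBond P' 0 // (⟨φ b'.src, Fin.cast hd b'.dir⟩ : PBond P 0) = b}, g b')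
    (hρP : ∀ (g : PlaqSpace P') (p : Plaq P 0), ρP g p = ∑ p' : {p' : Plaq P' 0 // (⟨φ p'.src, Fin.cast hd p'.μ, Fin.cast hd p'.ν, Fin.lt_def.mpr (Fin.lt_def.mp p'.hμν)⟩ : Plaq P 0) = p}, g p')
    (hρI : ∀ (g : BondIdxSpace D') (c : BondIdx D), ρI g c = ∑ c' : {c' // ψI c' = c}, g c')
    (hρSI : ∀ (g : SiteIdxSpace D') (s : SiteIdx D), ρSI g s = ∑ s' : {s' // ψS s' = s}, g s')
    (hQpull : ∀ (A : PBond P 0 → ℝ) (c' : BondIdx D'),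
      bondAvgIter ((ψI c').1.1 : ℕ) A (ψI c').1.2 = bondAvgIter (c'.1.1 : ℕ) (fun b' : PBond P' 0 => A ⟨φ b'.src, Fin.cast hd b'.dir⟩) c'.1.2)
    (hQpush : ∀ (g : PBond P' 0 → ℝ) (c : BondIdx D), (∑ c' : {c' // ψI c' = c}, bondAvgIter (c'.1.1.1 : ℕ) g c'.1.1.2) =
      bondAvgIter (c.1.1 : ℕ) (fun b : PBond P 0 => ∑ b' : {b' : PBond P' 0 // (⟨φ b'.src, Fin.cast hd b'.dir⟩ : PBond P 0) = b}, g b') c.1.2)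
    (hQ'pull : ∀ (f : Site P 0 → ℝ) (s' : SiteIdx D'),
      siteAvgIter ((ψS s').1.1 : ℕ) f (ψS s').1.2 = siteAvgIter (s'.1.1 : ℕ) (f ∘ φ) s'.1.2)
    (hQ'push : ∀ (g : Site P' 0 → ℝ) (s : SiteIdx D), (∑ s' : {s' // ψS s' = s}, siteAvgIter (s'.1.1.1 : ℕ) g s'.1.1.2) =
      siteAvgIter (s.1.1 : ℕ) (fun x : Site P 0 => ∑ x' : {x' // φ x' = x}, g x') s.1.2)
    (u : BondSpace P) :
    deltaAE D' c (w ∘ ψI) (onE (LinearMap.funLeft ℝ ℝ (fun b' : PBond P' 0 => (⟨φ b'.src, Fin.cast hd b'.dir⟩ : PBond P 0))) u) = onE (LinearMap.funLeft ℝ ℝ (fun b' : PBond P' 0 => (⟨φ b'.src, Fin.cast hd b'.dir⟩ : PBond P 0))) (deltaAE D c w u) := by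
  refine deltaAE_intertwine_of_summands D D' (onE (LinearMap.funLeft ℝ ℝ (fun b' : PBond P' 0 => (⟨φ b'.src, Fin.cast hd b'.dir⟩ : PBond P 0)))) (fun v => curlCurl_pull hd φ hs hu c ρB ρP hρB hρP v)
    (fun v => ?_) (fun v => ?_) u
  · rw [LinearMap.comp_apply, LinearMap.comp_apply, LinearMap.comp_apply, LinearMap.comp_apply, dsE_pull hd φ hu,
      RE_pull hd φ hs hu D D' ψS c ρS ρSI hρS hρSI hQ'pull hQ'push, dE_pull hd φ hs]
  · rw [LinearMap.comp_apply, LinearMap.comp_apply, LinearMap.comp_apply, LinearMap.comp_apply, QE_pull hd φ D D' ψI hQpull, aE_pull,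
      QsE_pull hd φ D D' ψI ρB ρI hρB hρI hQpush]

include hs hu in
/-- ★★ **`H′ ∘ πI = πB ∘ H` FOR `H = GQ*(QGQ*)⁻¹` ON A COVERING** — the key lemma of branch (α) modulo the reading `IsFlatH` (weights `w ∘ ψI`; for the P2 text
`w ≡ 1`). [cite: Balaban1984PropagatorsII, (2.35) p.228; Balaban1985Variational, (45) p.285, (157) p.302] -/
theorem hOp_pull {c : ℝ} (hc : c ≠ 0) {w : BondIdx D → ℝ} (hw : ∀ i, 0 < w i)
    (ρS : ScalarSpace P' →ₗ[ℝ] ScalarSpace P) (ρB : BondSpace P' →ₗ[ℝ] BondSpace P) (ρP : PlaqSpace P' →ₗ[ℝ] PlaqSpace P)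
    (ρI : BondIdxSpace D' →ₗ[ℝ] BondIdxSpace D) (ρSI : SiteIdxSpace D' →ₗ[ℝ] SiteIdxSpace D)
    (hρS : ∀ (g : ScalarSpace P') (x : Site P 0), ρS g x = ∑ x' : {x' // φ x' = x}, g x')
    (hρB : ∀ (g : BondSpace P') (b : PBond P 0), ρB g b = ∑ b' : {b' : PBond P' 0 // (⟨φ b'.src, Fin.cast hd b'.dir⟩ : PBond P 0) = b}, g b')
    (hρP : ∀ (g : PlaqSpace P') (p : Plaq P 0), ρP g p = ∑ p' : {p' : Plaq P' 0 // (⟨φ p'.src, Fin.cast hd p'.μ, Fin.cast hd p'.ν, Fin.lt_def.mpr (Fin.lt_def.mp p'.hμν)⟩ : Plaq P 0) = p}, g p')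
    (hρI : ∀ (g : BondIdxSpace D') (c : BondIdx D), ρI g c = ∑ c' : {c' // ψI c' = c}, g c')
    (hρSI : ∀ (g : SiteIdxSpace D') (s : SiteIdx D), ρSI g s = ∑ s' : {s' // ψS s' = s}, g s')
    (hQpull : ∀ (A : PBond P 0 → ℝ) (c' : BondIdx D'),
      bondAvgIter ((ψI c').1.1 : ℕ) A (ψI c').1.2 = bondAvgIter (c'.1.1 : ℕ) (fun b' : PBond P' 0 => A ⟨φ b'.src, Fin.cast hd b'.dir⟩) c'.1.2)
    (hQpush : ∀ (g : PBond P' 0 → ℝ) (c : BondIdx D), (∑ c' : {c' // ψI c' = c}, bondAvgIter (c'.1.1.1 : ℕ) g c'.1.1.2) =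
      bondAvgIter (c.1.1 : ℕ) (fun b : PBond P 0 => ∑ b' : {b' : PBond P' 0 // (⟨φ b'.src, Fin.cast hd b'.dir⟩ : PBond P 0) = b}, g b') c.1.2)
    (hQ'pull : ∀ (f : Site P 0 → ℝ) (s' : SiteIdx D'),
      siteAvgIter ((ψS s').1.1 : ℕ) f (ψS s').1.2 = siteAvgIter (s'.1.1 : ℕ) (f ∘ φ) s'.1.2)
    (hQ'push : ∀ (g : Site P' 0 → ℝ) (s : SiteIdx D), (∑ s' : {s' // ψS s' = s}, siteAvgIter (s'.1.1.1 : ℕ) g s'.1.1.2) =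
      siteAvgIter (s.1.1 : ℕ) (fun x : Site P 0 => ∑ x' : {x' // φ x' = x}, g x') s.1.2)
    (ω : BondIdxSpace D) :
    hOp (GE D' hc (w := w ∘ ψI) (fun i => hw (ψI i))) (QsE D') (EE D' hc (w := w ∘ ψI) (fun i => hw (ψI i))) (onE (LinearMap.funLeft ℝ ℝ ψI) ω) =
      onE (LinearMap.funLeft ℝ ℝ (fun b' : PBond P' 0 => (⟨φ b'.src, Fin.cast hd b'.dir⟩ : PBond P 0))) (hOp (GE D hc hw) (QsE D) (EE D hc hw) ω) :=
  hOp_intertwine D D' hc hw (fun i => hw (ψI i)) (onE (LinearMap.funLeft ℝ ℝ (fun b' : PBond P' 0 => (⟨φ b'.src, Fin.cast hd b'.dir⟩ : PBond P 0)))) (onE (LinearMap.funLeft ℝ ℝ ψI))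
    (deltaAE_pull hd φ hs hu D D' ψI ψS c w ρS ρB ρP ρI ρSI hρS hρB hρP hρI hρSI hQpull hQpush hQ'pull hQ'push)
    (QE_pull hd φ D D' ψI hQpull) (QsE_pull hd φ D D' ψI ρB ρI hρB hρI hQpush) ω

end Assembly

end Summit.QuantumFields.YangMills.Theorems.CoverFlatOps

end
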